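import Summits.HodgeConjecture.HodgeConjecture.Theorems.F0P3SmoothInvariantFormRigidity
import Summits.HodgeConjecture.HodgeConjecture.Theorems.F0P3ProjectionPreservesType
import Summits.HodgeConjecture.HodgeConjecture.Theorems.F0P3CotangentFormL2Span
import Summits.HodgeConjecture.HodgeConjecture.Theorems.F0P2aStubAdmissibleOfCohValued
import Summits.HodgeConjecture.HodgeConjecture.Theorems.F0P2aFrameTransport
import Summits.HodgeConjecture.HodgeConjecture.Theorems.F0P2aCmFrameFactorisation
import Summits.HodgeConjecture.HodgeConjecture.Theorems.F0P3HolProjectionReduction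
import Summits.HodgeConjecture.HodgeConjecture.Theorems.F0P3TranslateDetection
import Mathlib.Analysis.InnerProductSpace.Projection.Submodule
import HarnessLib

/-!
# Crux `H413` — F1b road (HILBERT ROUTE), brick (A4c) = (H5): the common finite component `σ` of a hol-type discrete `P` is ADMISSIBLE

Floor-0 programme P3, seat F0P3-p04 (g4); crux item stmt-HodgeConjecture-24833 (`HCCMUnconditional.H413`), line `Cruxes/H413/Lines/F0_U3LettersRung1.lean`
ed. 2.5 (open stub `stub_F1b_cm : StubF1bCM`[v5]); planner ruling F0P3-plan (g3) 2026-08-31T03:45:58Z (F2): brick (A4c) of the `P₀` spine, consumed BY NAME as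
the `hρ : σ.IsAdmissible` input of ★ HB4 `F0P3SmoothInvariantFormRigidity` §4 in the closer of record `Theorems/F0P3StubF1bCM.lean`.
HC_CM is proved only modulo the printed citations until rung 0 closes.

THE POINT.  In `StubF1bCM`[v5] the common finite component `σ` is only IRREDUCIBLE and SMOOTH; step (A4b) (★ `F0P3GNSFinitePart`) embeds it
`P.finRep`-equivariantly into `P₀ := cl span {P.finRep b v₀}`, `v₀` the `L²`-class of a coordinate of a holomorphic cotangent form `Φ` of `P`.  Such a
`σ` is admissible, with NO regularity theory: for `K` compact open the orthogonal projection onto the `K`-fixed vectors is the finite averaging projector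
`e_K` on smooth vectors (★ HB4 §1), so `P₀ ⊓ P^K ≤ cl span {e_K (P.finRep b v₀)}`; each `e_K (P.finRep b v₀)` is the class of the level-`K` holomorphic
cotangent form `e_K (rightRep b Φ)` (dictionary ★ `SpectrumJunction.toLp_toQuotFun_mul_right`), and level-`K` holomorphic cotangent forms at the pin are
FINITE-DIMENSIONAL (★ `F0P2aStubAdmissibleOfCohValued.finite_fixedPoints_of_frameTransport`, Matsushima through ★ `F0P2aCohFormsFixedFinite`), so the span
is closed and `σ^K ↪ P₀ ⊓ P^K` is finite-dimensional.
§1 generic `isAdmissible_of_injective_equivariant`; §2 generic Hilbert `isClosed_fixedPoints`, `starProjection_fixedPoints_eq_avg`,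
`fixedPoints_inf_closure_span_orbit_le`; §3 CM pin `rightRep_mem_holCotForms`, `finite_holCotForms_inf_fixedPoints`, `toLp_rightRep_apply`,
`finiteDimensional_closureSpan_inf_fixedPoints`, HEAD **`isAdmissible_of_range_le_closureSpan`**.

Sources: Bernstein–Zelevinsky (1976) §2.1 [BernsteinZelevinsky1976]; Borel–Jacquet, Corvallis (1979) §4.2–4.3, §4.6 [BorelJacquetCorvallis1979];
Borel–Wallach (2000) VII 3.2, XIII 1.2 [BorelWallach2000]; Bump (1997) §4.2 [Bump1997].  No definition, no sorry, no named fact;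
`--supports stmt-HodgeConjecture-24833 --as helper`.
-/

set_option autoImplicit false
-- the mandated namespace repeats `HodgeConjecture.HodgeConjecture`, as in every `Theorems/*.lean` of this sub-problem
set_option linter.dupNamespace false

noncomputable section

open scoped InnerProductSpace ComplexConjugate Matrix ComplexOrder
open MeasureTheory NumberField

namespace Summit.HodgeConjecture.HodgeConjecture.Cruxes.H413.F0P3FinComponentAdmissible

open Literature.NumberTheory.Automorphic.SmoothProjector
open Summit.HodgeConjecture.HodgeConjecture.Cruxes.H413.F0P3SmoothInvariantFormRigidity

/-! ## §1 Generic: an injective equivariant map into finite-dimensional level pieces forces admissibility -/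

section Generic

variable {B : Type*} [Group B] [TopologicalSpace B] {W V : Type*} [AddCommGroup W] [Module ℂ W] [AddCommGroup V] [Module ℂ V]

/-- **Admissibility from an injective equivariant map.**  `σ` smooth, `ψ : σ → ρ` injective, `B`-equivariant, with values in a subspace `S ≤ V`
such that `S ⊓ V^K` is finite-dimensional for every compact open `K ≤ B`; then `σ` is admissible (`σ^K ↪ S ⊓ V^K`).
[cite: BernsteinZelevinsky1976, §2.1] [cite: Bump1997, §4.2] -/
theorem isAdmissible_of_injective_equivariant {σ : Representation ℂ B W} (hσ : σ.IsSmooth) {ρ : Representation ℂ B V}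
    (ψ : W →ₗ[ℂ] V) (hψ : ∀ (b : B) (w : W), ψ (σ b w) = ρ b (ψ w)) (hinj : Function.Injective ψ)
    (S : Submodule ℂ V) (hS : ∀ w : W, ψ w ∈ S)
    (hfin : ∀ K : Subgroup B, IsOpen (K : Set B) → IsCompact (K : Set B) → FiniteDimensional ℂ ↥(S ⊓ ρ.fixedPoints K)) :
    σ.IsAdmissible := by
  refine ⟨hσ, fun K hK => ?_⟩
  haveI := hfin (K : Subgroup B) K.isOpen hK
  have hmem : ∀ w : ↥(σ.fixedPoints (K : Subgroup B)), ψ (w : W) ∈ S ⊓ ρ.fixedPoints (K : Subgroup B) := fun w => by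
    refine ⟨hS _, (Representation.mem_fixedPoints _ _ _).mpr fun g hg => ?_⟩
    rw [← hψ, (Representation.mem_fixedPoints _ _ _).mp w.2 g hg]
  let Ψ : ↥(σ.fixedPoints (K : Subgroup B)) →ₗ[ℂ] ↥(S ⊓ ρ.fixedPoints (K : Subgroup B)) :=
    { toFun := fun w => ⟨ψ (w : W), hmem w⟩
      map_add' := fun w w' => Subtype.ext (by simp only [Submodule.coe_add, map_add])
      map_smul' := fun c w => Subtype.ext (by simp only [Submodule.coe_smul, map_smul, RingHom.id_apply]) }
  have hΨ : Function.Injective Ψ := fun w w' h => Subtype.ext (hinj (congrArg (fun x : ↥(S ⊓ ρ.fixedPoints (K : Subgroup B)) => (x : V)) h))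
  exact FiniteDimensional.of_injective Ψ hΨ

end Generic

/-! ## §2 Generic Hilbert: the `K`-fixed part of a closed cyclic span lies in the closed span of the averaged orbit -/

section Hilbert

variable {Γ B : Type*} [Group Γ] [Group B] [TopologicalSpace B] [IsTopologicalGroup B]
  {H : Type*} [NormedAddCommGroup H] [InnerProductSpace ℂ H] [CompleteSpace H]

omit [TopologicalSpace B] [IsTopologicalGroup B] [CompleteSpace H] in
/-- The `K`-fixed vectors of `π ∘ β` form a CLOSED subspace (an intersection of equalisers of continuous operators). [folklore] -/
theorem isClosed_fixedPoints (π : ContRepresentation ℂ Γ H) (β : B →* Γ) (K : Subgroup B) :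
    IsClosed ((Representation.fixedPoints (π.toRepresentation.comp β) K : Submodule ℂ H) : Set H) := by
  have hset : ((Representation.fixedPoints (π.toRepresentation.comp β) K : Submodule ℂ H) : Set H) = ⋂ k ∈ K, {x : H | π (β k) x = x} := by
    ext x
    simp only [SetLike.mem_coe, Set.mem_iInter, Set.mem_setOf_eq, Representation.mem_fixedPoints]
    rfl
  rw [hset]
  exact isClosed_biInter fun k _ => isClosed_eq (π (β k)).continuous continuous_id

/-- **The orthogonal projection onto `V^K` is the averaging projector `e_K` on smooth vectors** (`π` unitary, `K` compact): `e_K y ∈ V^K` (★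
`avg_mem_fixedPoints`) and `y − e_K y ⟂ V^K` (★ HB4 `form_apply_avg_left` for the invariant form `⟪·,·⟫`). [cite: Bump1997, §4.2] -/
theorem starProjection_fixedPoints_eq_avg (π : ContRepresentation ℂ Γ H) (hπ : π.IsUnitary) (β : B →* Γ) {K : Subgroup B}
    (hK : IsCompact (K : Set B)) [(Representation.fixedPoints (π.toRepresentation.comp β) K).HasOrthogonalProjection]
    {y : H} (hy : Representation.IsSmoothVector (π.toRepresentation.comp β) y) :
    (Representation.fixedPoints (π.toRepresentation.comp β) K).starProjection y = avg (π.toRepresentation.comp β) K y := by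
  set ρ : Representation ℂ B H := π.toRepresentation.comp β with hρ
  refine Submodule.eq_starProjection_of_mem_of_inner_eq_zero (avg_mem_fixedPoints hK hy) fun w hw => ?_
  have hB : ∀ (g : B) (x z : H), innerₛₗ ℂ (ρ g x) (ρ g z) = innerₛₗ ℂ x z :=
    fun g x z => by
      rw [innerₛₗ_apply_apply, innerₛₗ_apply_apply]
      exact hπ.inner_map_map (β g) x z
  have h := form_apply_avg_left (ρ := ρ) (innerₛₗ ℂ) hB hK hy hw
  rw [innerₛₗ_apply_apply, innerₛₗ_apply_apply] at h
  rw [inner_sub_left, h, sub_self]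

/-- **`V^K ⊓ cl span {π(β b) v₀} ≤ cl span {e_K (π(β b) v₀)}`** for `π` unitary, `K` compact and `v₀` a smooth vector of `π ∘ β`: the orthogonal
projection `Q` onto the closed `V^K` fixes the left side, is continuous, and maps each `π(β b) v₀` (a smooth vector) to `e_K (π(β b) v₀)`
(`starProjection_fixedPoints_eq_avg`), so `Q (cl span) ⊆ cl (Q span) = cl span {e_K (π(β b) v₀)}`. [cite: Bump1997, §4.2] [cite: BorelJacquetCorvallis1979, §4.3] -/
theorem fixedPoints_inf_closure_span_orbit_le (π : ContRepresentation ℂ Γ H) (hπ : π.IsUnitary) (β : B →* Γ) {K : Subgroup B}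
    (hK : IsCompact (K : Set B)) (v₀ : H) (hv₀ : Representation.IsSmoothVector (π.toRepresentation.comp β) v₀) :
    Representation.fixedPoints (π.toRepresentation.comp β) K ⊓ (Submodule.span ℂ (Set.range fun b : B => π (β b) v₀)).topologicalClosure ≤
      (Submodule.span ℂ (Set.range fun b : B => avg (π.toRepresentation.comp β) K (π (β b) v₀))).topologicalClosure := by
  set ρ : Representation ℂ B H := π.toRepresentation.comp β with hρ
  set F : Submodule ℂ H := ρ.fixedPoints K with hF
  haveI : CompleteSpace F := (isClosed_fixedPoints π β K).completeSpace_coe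
  haveI : F.HasOrthogonalProjection := Submodule.HasOrthogonalProjection.ofCompleteSpace F
  rintro x ⟨hxF, hxC⟩
  have hQx : F.starProjection x = x := Submodule.starProjection_eq_self_iff.mpr hxF
  have hQorb : ∀ b : B, F.starProjection (π (β b) v₀) = avg ρ K (π (β b) v₀) := fun b => by
    have hyb : ρ.IsSmoothVector (π (β b) v₀) := Representation.IsSmoothVector.apply ρ b hv₀
    exact starProjection_fixedPoints_eq_avg π hπ β hK hyb
  have hQspan : (Submodule.span ℂ (Set.range fun b : B => π (β b) v₀)).map (F.starProjection : H →ₗ[ℂ] H) =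
      Submodule.span ℂ (Set.range fun b : B => avg ρ K (π (β b) v₀)) := by
    rw [Submodule.map_span]
    congr 1
    ext y
    constructor
    · rintro ⟨_, ⟨b, rfl⟩, rfl⟩
      exact ⟨b, (hQorb b).symm⟩
    · rintro ⟨b, rfl⟩
      exact ⟨π (β b) v₀, ⟨b, rfl⟩, hQorb b⟩
  have himg : F.starProjection x ∈ closure ((F.starProjection : H → H) '' (Submodule.span ℂ (Set.range fun b : B => π (β b) v₀) : Set H)) :=
    image_closure_subset_closure_image F.starProjection.continuous ⟨x, by simpa only [Submodule.topologicalClosure_coe] using hxC, rfl⟩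
  have hset : (F.starProjection : H → H) '' (Submodule.span ℂ (Set.range fun b : B => π (β b) v₀) : Set H) =
      (Submodule.span ℂ (Set.range fun b : B => avg ρ K (π (β b) v₀)) : Set H) := by
    rw [← hQspan, Submodule.map_coe]
    rfl
  rw [← hQx]
  rw [hset, ← Submodule.topologicalClosure_coe] at himg
  exact himg

end Hilbert

/-! ## §3 The CM pin: level-`K` holomorphic cotangent forms are finite-dimensional, hence so is `P₀ ⊓ P^K` -/

section CM

open Literature.NumberTheory.Automorphic Literature.NumberTheory.Automorphic.UnitaryGroup
open Literature.NumberTheory.Automorphic.UnitaryGroup.CotangentForms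
open Literature.Geometry.ComplexHyperbolic.BallModel (U21 J)
open Summit.HodgeConjecture.HodgeConjecture.Cruxes.H413.SpectrumJunction
open Summit.HodgeConjecture.HodgeConjecture.Cruxes.H413.F0P3ProjectionPreservesType
open Summit.HodgeConjecture.HodgeConjecture.Cruxes.H413.F0P3CotangentFormL2Span (memLp_toQuotFun_apply)
open Summit.HodgeConjecture.HodgeConjecture.Cruxes.H413.F0P3HolProjectionReduction (compactSpace_automorphicQuotient_cm)
open Summit.HodgeConjecture.HodgeConjecture.Cruxes.H413.F0P2aFrameTransport
open Summit.HodgeConjecture.HodgeConjecture.Cruxes.H413.F0P2aCmFrameFactorisation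
open Summit.HodgeConjecture.HodgeConjecture.Cruxes.H413.F0P2aStubAdmissibleOfCohValued

variable {L : Type} [Field L] [NumberField L] [IsCMField L] (ι : L →+* ℂ) {H : Matrix (Fin 3) (Fin 3) L}
  (T : GL (Fin 3) ℂ) (hT : (T : Matrix (Fin 3) (Fin 3) ℂ)ᴴ * H.map ι * (T : Matrix (Fin 3) (Fin 3) ℂ) = J)

/-- **Holomorphic cotangent forms are stable under finite-adelic right translation** at the CM frame: the finite adeles commute with
`ι_∞(U(2,1))` (★ `cmArchSection_mul_finAdelicToAdelic`) and with `K_c` (★ `mul_finAdelicToAdelic_of_mem_cmCompactFactor`), so the `K_∞`-type, the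
`K_c`-invariance and the holomorphic germs ride along (★ `F0P2aFrameTransport`), and a translate of a smooth vector is smooth.
[cite: BorelJacquetCorvallis1979, §4.2] [cite: BorelWallach2000, VII 2.10] -/
theorem rightRep_mem_holCotForms
    {Φ : (adelicGroupData (↥(maximalRealSubfield L)) L (IsCMField.complexConj L) 3 H).Adelic → (Fin 2 → ℂ)}
    (hΦ : Φ ∈ holCotForms (↥(maximalRealSubfield L)) L (IsCMField.complexConj L) 3 H (cmArchSection L ι H T hT) (cmCompactFactor L ι H T hT))
    (b : finAdelic (↥(maximalRealSubfield L)) L (IsCMField.complexConj L) 3 H) :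
    rightRep (↥(maximalRealSubfield L)) L (IsCMField.complexConj L) 3 H b Φ ∈
      holCotForms (↥(maximalRealSubfield L)) L (IsCMField.complexConj L) 3 H (cmArchSection L ι H T hT) (cmCompactFactor L ι H T hT) := by
  have hΦ' := hΦ
  rw [mem_holCotForms_iff] at hΦ ⊢
  obtain ⟨hw, hK, hs, hh⟩ := hΦ
  have hrel : ∀ u : U21, cmArchSection L ι H T hT u * finAdelicToAdelic (↥(maximalRealSubfield L)) L (IsCMField.complexConj L) 3 H b =
      finAdelicToAdelic (↥(maximalRealSubfield L)) L (IsCMField.complexConj L) 3 H b * cmArchSection L ι H T hT u :=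
    fun u => cmArchSection_mul_finAdelicToAdelic L ι H T hT u b
  refine ⟨mem_weightForms_comp_mul_right_of_rel hrel hw, fun k hk x => ?_, ?_, isHolGerm_comp_mul_right_of_rel hrel hh⟩
  · show Φ (x * k * finAdelicToAdelic (↥(maximalRealSubfield L)) L (IsCMField.complexConj L) 3 H b) =
      Φ (x * finAdelicToAdelic (↥(maximalRealSubfield L)) L (IsCMField.complexConj L) 3 H b)
    rw [mul_assoc, mul_finAdelicToAdelic_of_mem_cmCompactFactor L ι H T hT hk b, ← mul_assoc, hK k hk]
  · exact isSmoothVector_rightRep_iff_mem_smoothFun.mp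
      (Representation.IsSmoothVector.apply (rightRep (↥(maximalRealSubfield L)) L (IsCMField.complexConj L) 3 H) b
        (isSmoothVector_rightRep_iff_mem_smoothFun.mpr hs))

/-- **Level-`K` holomorphic cotangent forms at the CM pin are FINITE-DIMENSIONAL** (`K ≤ U(H)(𝔸_{L⁺,f})` compact open): ★
`F0P2aStubAdmissibleOfCohValued.finite_fixedPoints_of_frameTransport` applied to the representation `rightRep` on the holomorphic cotangent forms
themselves (inclusion as the equivariant map), the hermitian 3-space `(H, T)` over `⟨L⟩` and the frame transport ★ `mem_cohForms_frameTransport` —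
Matsushima's `H^{1,0}` of the compact level-`K` ball quotient, reached through ★ `F0P2aCohFormsFixedFinite`.
[cite: BorelWallach2000, VII 3.2 and XIII 1.2] [cite: BorelJacquetCorvallis1979, §4.3] -/
theorem finite_holCotForms_inf_fixedPoints
    (hdef : ∀ τ' : L →+* ℂ, InfinitePlace.mk τ' ≠ InfinitePlace.mk ι → (H.map τ').PosDef) (h2 : 2 ≤ Module.finrank ℚ ↥(maximalRealSubfield L))
    (K : Subgroup (finAdelic (↥(maximalRealSubfield L)) L (IsCMField.complexConj L) 3 H))
    (hKo : IsOpen (K : Set (finAdelic (↥(maximalRealSubfield L)) L (IsCMField.complexConj L) 3 H)))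
    (hKc : IsCompact (K : Set (finAdelic (↥(maximalRealSubfield L)) L (IsCMField.complexConj L) 3 H))) :
    Module.Finite ℂ ↥(holCotForms (↥(maximalRealSubfield L)) L (IsCMField.complexConj L) 3 H (cmArchSection L ι H T hT) (cmCompactFactor L ι H T hT) ⊓
      (rightRep (↥(maximalRealSubfield L)) L (IsCMField.complexConj L) 3 H).fixedPoints K) := by
  -- the hermitian 3-space `V₀ = (H, T)` over the bundled CM field `⟨L⟩`
  obtain ⟨V₀, hV₀⟩ : ∃ V₀ : HodgeCM.HermSpace3 (⟨L⟩ : HodgeCM.CMField) ι, HodgeCM.HermSpace3.Hm V₀ = H :=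
    ⟨⟨H, fun i j => cmConjRingHom_apply_eq_of_formCongr_eq_J L H ι T (formCongr_eq_of_conjTranspose L ι H T hT) i j,
      ⟨T, by rw [Literature.AlgebraicGeometry.ShimuraVarieties.UnitaryBallUniformisationDatum.signatureMatrix_two]; exact hT⟩, hdef⟩, rfl⟩
  subst hV₀
  have h4 : 4 ≤ Module.finrank ℚ (⟨L⟩ : HodgeCM.CMField) := by
    have h := Module.finrank_mul_finrank ℚ ↥(maximalRealSubfield L) L
    rw [Algebra.IsQuadraticExtension.finrank_eq_two ↥(maximalRealSubfield L) L] at h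
    change 4 ≤ Module.finrank ℚ L
    omega
  obtain ⟨a, hcomm, hmem⟩ := mem_cohForms_frameTransport L ι (HodgeCM.HermSpace3.Hm V₀) T V₀.sylvesterFrame hT (HodgeCM.Model.sylvesterFrame_J V₀)
  -- `rightRep` on the holomorphic cotangent forms, with the inclusion as equivariant map
  set Hol := holCotForms (↥(maximalRealSubfield L)) L (IsCMField.complexConj L) 3 (HodgeCM.HermSpace3.Hm V₀)
    (cmArchSection L ι (HodgeCM.HermSpace3.Hm V₀) T hT) (cmCompactFactor L ι (HodgeCM.HermSpace3.Hm V₀) T hT) with hHol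
  have hstab : ∀ g : finAdelic (↥(maximalRealSubfield L)) L (IsCMField.complexConj L) 3 (HodgeCM.HermSpace3.Hm V₀),
      Hol ≤ Hol.comap (rightRep (↥(maximalRealSubfield L)) L (IsCMField.complexConj L) 3 (HodgeCM.HermSpace3.Hm V₀) g) :=
    fun g Φ hΦ => rightRep_mem_holCotForms ι T hT hΦ g
  let σ := (rightRep (↥(maximalRealSubfield L)) L (IsCMField.complexConj L) 3 (HodgeCM.HermSpace3.Hm V₀)).subrepresentation Hol hstab
  haveI hfin : Module.Finite ℂ ↥(σ.fixedPoints K) :=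
    finite_fixedPoints_of_frameTransport ⟨L⟩ V₀ h4 _ a (fun g => (hcomm g).eq) hmem σ Hol.subtype (fun g w => rfl)
      (fun w => holCotForms_le_cohForms w.2) Subtype.val_injective K hKo hKc
  -- `Hol ⊓ Fix(K)` is the image of `σ^K` under the inclusion `Hol ↪ functions`
  have heq : Hol ⊓ (rightRep (↥(maximalRealSubfield L)) L (IsCMField.complexConj L) 3 (HodgeCM.HermSpace3.Hm V₀)).fixedPoints K =
      (σ.fixedPoints K).map Hol.subtype := by
    ext Φ
    constructor
    · rintro ⟨hΦ, hfix⟩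
      have hfix' : ∀ g ∈ K, rightRep (↥(maximalRealSubfield L)) L (IsCMField.complexConj L) 3 (HodgeCM.HermSpace3.Hm V₀) g Φ = Φ :=
        (Representation.mem_fixedPoints _ _ _).mp hfix
      exact ⟨⟨Φ, hΦ⟩, (Representation.mem_fixedPoints _ _ _).mpr fun g hg => Subtype.ext (hfix' g hg), rfl⟩
    · rintro ⟨w, hw, rfl⟩
      have hw' : ∀ g ∈ K, σ g w = w := (Representation.mem_fixedPoints _ _ _).mp hw
      exact ⟨w.2, (Representation.mem_fixedPoints _ _ _).mpr fun g hg => congrArg Subtype.val (hw' g hg)⟩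
  rw [heq]
  infer_instance

variable (μ : Measure (adelicGroupData (↥(maximalRealSubfield L)) L (IsCMField.complexConj L) 3 H).automorphicQuotient)
  [(adelicGroupData (↥(maximalRealSubfield L)) L (IsCMField.complexConj L) 3 H).IsAutomorphicMeasure μ]

/-- **Class ∕ translation dictionary**: the `L²`-class of the `j`-th coordinate of the right translate `rightRep b Ψ` of a holomorphic cotangent form
is `R(1, b)` applied to the class of the `j`-th coordinate of `Ψ` (★ `SpectrumJunction.toLp_toQuotFun_mul_right`). [cite: BorelJacquetCorvallis1979, §4.6] -/
theorem toLp_rightRep_apply [CompactSpace (adelicGroupData (↥(maximalRealSubfield L)) L (IsCMField.complexConj L) 3 H).automorphicQuotient]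
    {Ψ : (adelicGroupData (↥(maximalRealSubfield L)) L (IsCMField.complexConj L) 3 H).Adelic → (Fin 2 → ℂ)}
    (hΨ : Ψ ∈ holCotForms (↥(maximalRealSubfield L)) L (IsCMField.complexConj L) 3 H (cmArchSection L ι H T hT) (cmCompactFactor L ι H T hT))
    (b : finAdelic (↥(maximalRealSubfield L)) L (IsCMField.complexConj L) 3 H) (j : Fin 2) :
    (memLp_toQuotFun_apply ι T hT (μ := μ) (rightRep_mem_holCotForms ι T hT hΨ b) j).toLp
        (toQuotFun (adelicGroupData (↥(maximalRealSubfield L)) L (IsCMField.complexConj L) 3 H)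
          fun x => rightRep (↥(maximalRealSubfield L)) L (IsCMField.complexConj L) 3 H b Ψ x j) =
      (adelicGroupData (↥(maximalRealSubfield L)) L (IsCMField.complexConj L) 3 H).rightRegular μ
        (finAdelicToAdelic (↥(maximalRealSubfield L)) L (IsCMField.complexConj L) 3 H b)
        ((memLp_toQuotFun_apply ι T hT (μ := μ) hΨ j).toLp
          (toQuotFun (adelicGroupData (↥(maximalRealSubfield L)) L (IsCMField.complexConj L) 3 H) fun x => Ψ x j)) :=
  by
  have hleft : ∀ γ ∈ (adelicGroupData (↥(maximalRealSubfield L)) L (IsCMField.complexConj L) 3 H).quotientSubgroup, ∀ g,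
      (fun x => Ψ x j) (γ * g) = (fun x => Ψ x j) g := fun γ hγ g => by
    simp only [leftInvariant_of_mem_holCotForms hΨ γ hγ g]
  exact toLp_toQuotFun_mul_right hleft (finAdelicToAdelic (↥(maximalRealSubfield L)) L (IsCMField.complexConj L) 3 H b)
    (memLp_toQuotFun_apply ι T hT (μ := μ) hΨ j) (memLp_toQuotFun_apply ι T hT (μ := μ) (rightRep_mem_holCotForms ι T hT hΨ b) j)

/-- **`P₀ ⊓ P^K` IS FINITE-DIMENSIONAL.**  For a hol-type setting (`hdef`, `h2`), a holomorphic cotangent form `Φ`, a vector `v₀ ∈ P` whose `L²`-class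
is the class of the `j`-th coordinate of `Φ`, and `K ≤ U(H)(𝔸_{L⁺,f})` compact open:
`FiniteDimensional ℂ ↥(cl span {P.finRep b v₀} ⊓ (P.finRep).fixedPoints K)`.  §2 reduces to the span of the averages `e_K (P.finRep b v₀)`; each is the
class of the level-`K` holomorphic cotangent form `e_K (rightRep b Φ)` (same coset sum ★ `avg_eq_index_inv_smul_finsum`, dictionary
`toLp_rightRep_apply`), so that span lies in the image of the finite-dimensional `holCotForms ⊓ Fix(K)` (`finite_holCotForms_inf_fixedPoints`) and is
closed. [cite: BorelJacquetCorvallis1979, §4.3 and §4.6] [cite: Bump1997, §4.2] [cite: BorelWallach2000, XIII 1.2] -/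
theorem finiteDimensional_closureSpan_inf_fixedPoints
    (hdef : ∀ τ' : L →+* ℂ, InfinitePlace.mk τ' ≠ InfinitePlace.mk ι → (H.map τ').PosDef) (h2 : 2 ≤ Module.finrank ℚ ↥(maximalRealSubfield L))
    (P : DiscreteAutomorphicRep (adelicGroupData (↥(maximalRealSubfield L)) L (IsCMField.complexConj L) 3 H) μ)
    {Φ : (adelicGroupData (↥(maximalRealSubfield L)) L (IsCMField.complexConj L) 3 H).Adelic → (Fin 2 → ℂ)}
    (hΦ : Φ ∈ holCotForms (↥(maximalRealSubfield L)) L (IsCMField.complexConj L) 3 H (cmArchSection L ι H T hT) (cmCompactFactor L ι H T hT))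
    (v₀ : P.space.toSubmodule) (j : Fin 2)
    (hv₀ : ∃ hm : MemLp (toQuotFun (adelicGroupData (↥(maximalRealSubfield L)) L (IsCMField.complexConj L) 3 H) fun x => Φ x j) 2 μ,
      (v₀ : (adelicGroupData (↥(maximalRealSubfield L)) L (IsCMField.complexConj L) 3 H).L2 μ) = hm.toLp _)
    (K : Subgroup (finAdelic (↥(maximalRealSubfield L)) L (IsCMField.complexConj L) 3 H))
    (hKo : IsOpen (K : Set (finAdelic (↥(maximalRealSubfield L)) L (IsCMField.complexConj L) 3 H)))
    (hKc : IsCompact (K : Set (finAdelic (↥(maximalRealSubfield L)) L (IsCMField.complexConj L) 3 H))) :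
    FiniteDimensional ℂ ↥((Submodule.span ℂ (Set.range fun b => P.finRep b v₀)).topologicalClosure ⊓ P.finRep.fixedPoints K) := by
  haveI := compactSpace_automorphicQuotient_cm hdef h2 (L := L) (ι := ι) (H := H)
  set Rf := rightRep (↥(maximalRealSubfield L)) L (IsCMField.complexConj L) 3 H with hRf
  set Hol := holCotForms (↥(maximalRealSubfield L)) L (IsCMField.complexConj L) 3 H (cmArchSection L ι H T hT) (cmCompactFactor L ι H T hT)
    with hHol
  obtain ⟨hm₀, hv₀⟩ := hv₀
  have hv₀' : (v₀ : (adelicGroupData (↥(maximalRealSubfield L)) L (IsCMField.complexConj L) 3 H).L2 μ) = (memLp_toQuotFun_apply ι T hT (μ := μ) hΦ j).toLp (toQuotFun (adelicGroupData (↥(maximalRealSubfield L)) L (IsCMField.complexConj L) 3 H) fun x => Φ x j) := hv₀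
  have hfinRep : ∀ (g : finAdelic (↥(maximalRealSubfield L)) L (IsCMField.complexConj L) 3 H) (v : P.space.toSubmodule),
      ((P.finRep g v : P.space.toSubmodule) : (adelicGroupData (↥(maximalRealSubfield L)) L (IsCMField.complexConj L) 3 H).L2 μ) =
        (adelicGroupData (↥(maximalRealSubfield L)) L (IsCMField.complexConj L) 3 H).rightRegular μ (finAdelicToAdelic (↥(maximalRealSubfield L)) L (IsCMField.complexConj L) 3 H g) (v : (adelicGroupData (↥(maximalRealSubfield L)) L (IsCMField.complexConj L) 3 H).L2 μ) := fun g v => rfl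
  have hv₀sm : P.finRep.IsSmoothVector v₀ := by
    refine P.finRep.isSmoothVector_of_le (isOpen_stabilizer hΦ) fun g hg => ?_
    rw [Representation.mem_stabilizerSubgroup]
    apply Subtype.ext
    rw [hfinRep, hv₀']
    exact rightRegular_toLp_of_mem_stabilizer hΦ hg (memLp_toQuotFun_apply ι T hT (μ := μ) hΦ j)
  have hle := fixedPoints_inf_closure_span_orbit_le P.space.toContRep (F0P3TranslateDetection.isUnitary_toContRep P)
    (finAdelicToAdelic (↥(maximalRealSubfield L)) L (IsCMField.complexConj L) 3 H) hKc v₀ hv₀sm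
  let cls : ↥Hol →ₗ[ℂ] (adelicGroupData (↥(maximalRealSubfield L)) L (IsCMField.complexConj L) 3 H).L2 μ :=
    { toFun := fun Ψ => (memLp_toQuotFun_apply ι T hT (μ := μ) Ψ.2 j).toLp (toQuotFun (adelicGroupData (↥(maximalRealSubfield L)) L (IsCMField.complexConj L) 3 H) fun x => (Ψ : (adelicGroupData (↥(maximalRealSubfield L)) L (IsCMField.complexConj L) 3 H).Adelic → (Fin 2 → ℂ)) x j)
      map_add' := fun Ψ Ψ' => by
        rw [← MemLp.toLp_add]
        exact MemLp.toLp_congr _ _ (Filter.EventuallyEq.of_eq rfl)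
      map_smul' := fun c Ψ => by
        rw [RingHom.id_apply, ← MemLp.toLp_const_smul]
        exact MemLp.toLp_congr _ _ (Filter.EventuallyEq.of_eq rfl) }
  have hcls : ∀ Ψ : ↥Hol, cls Ψ = (memLp_toQuotFun_apply ι T hT (μ := μ) Ψ.2 j).toLp (toQuotFun (adelicGroupData (↥(maximalRealSubfield L)) L (IsCMField.complexConj L) 3 H) fun x => (Ψ : (adelicGroupData (↥(maximalRealSubfield L)) L (IsCMField.complexConj L) 3 H).Adelic → (Fin 2 → ℂ)) x j) :=
    fun Ψ => rfl
  have hclsΦ : cls ⟨Φ, hΦ⟩ = (v₀ : (adelicGroupData (↥(maximalRealSubfield L)) L (IsCMField.complexConj L) 3 H).L2 μ) := by rw [hcls, hv₀']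
  have hclsR : ∀ (b : finAdelic (↥(maximalRealSubfield L)) L (IsCMField.complexConj L) 3 H) (Ψ : ↥Hol),
      cls ⟨Rf b Ψ, rightRep_mem_holCotForms ι T hT Ψ.2 b⟩ =
        (adelicGroupData (↥(maximalRealSubfield L)) L (IsCMField.complexConj L) 3 H).rightRegular μ (finAdelicToAdelic (↥(maximalRealSubfield L)) L (IsCMField.complexConj L) 3 H b) (cls Ψ) := fun b Ψ => by
    rw [hcls, hcls]
    exact toLp_rightRep_apply ι T hT μ Ψ.2 b j
  haveI : Module.Finite ℂ ↥(Hol ⊓ Rf.fixedPoints K) := finite_holCotForms_inf_fixedPoints ι T hT hdef h2 K hKo hKc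
  let AK : Submodule ℂ ((adelicGroupData (↥(maximalRealSubfield L)) L (IsCMField.complexConj L) 3 H).L2 μ) :=
    LinearMap.range (cls ∘ₗ Submodule.inclusion (inf_le_left : Hol ⊓ Rf.fixedPoints K ≤ Hol))
  haveI hAKfin : FiniteDimensional ℂ AK := LinearMap.finiteDimensional_range _
  let Tm : Submodule ℂ P.space.toSubmodule := Submodule.span ℂ (Set.range fun b => avg P.finRep K (P.finRep b v₀))
  have hTle : Tm.map P.space.toSubmodule.subtype ≤ AK := by
    rw [Submodule.map_span, Submodule.span_le]
    rintro _ ⟨_, ⟨b, rfl⟩, rfl⟩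
    have hΨb : Rf b Φ ∈ Hol := rightRep_mem_holCotForms ι T hT hΦ b
    have hΨsm : Rf.IsSmoothVector (Rf b Φ) :=
      Representation.IsSmoothVector.apply Rf b (isSmoothVector_rightRep_iff_mem_smoothFun.mpr (holCotForms_le_smoothFun hΦ))
    haveI := finiteIndex_stabIn hKc hΨsm
    haveI := finiteIndex_stabIn hKc (Representation.IsSmoothVector.apply P.finRep b hv₀sm)
    let B₀ : Subgroup K := stabIn Rf K (Rf b Φ)
    haveI : B₀.FiniteIndex := finiteIndex_stabIn hKc hΨsm
    haveI : Fintype (K ⧸ B₀) := Fintype.ofFinite _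
    have e2 : ((P.finRep b v₀ : P.space.toSubmodule) : (adelicGroupData (↥(maximalRealSubfield L)) L (IsCMField.complexConj L) 3 H).L2 μ) = cls ⟨Rf b Φ, hΨb⟩ := by
      rw [hfinRep, ← hclsΦ, ← hclsR b ⟨Φ, hΦ⟩]
    have ecls : ∀ g : (finAdelic (↥(maximalRealSubfield L)) L (IsCMField.complexConj L) 3 H), ((P.finRep g (P.finRep b v₀) : P.space.toSubmodule) : (adelicGroupData (↥(maximalRealSubfield L)) L (IsCMField.complexConj L) 3 H).L2 μ) =
        cls ⟨Rf g (Rf b Φ), rightRep_mem_holCotForms ι T hT hΨb g⟩ := fun g => by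
      rw [hfinRep, e2, ← hclsR g ⟨Rf b Φ, hΨb⟩]
    have hB₀' : B₀ ≤ stabIn P.finRep K (P.finRep b v₀) := by
      intro q hq
      rw [Subgroup.mem_subgroupOf, Representation.mem_stabilizerSubgroup] at hq ⊢
      apply Subtype.ext
      rw [ecls, e2]
      exact congrArg cls (Subtype.ext hq)
    have havgHol : avg Rf K (Rf b Φ) ∈ Hol := by
      rw [avg_eq_index_inv_smul_finsum B₀ le_rfl, finsum_eq_sum_of_fintype]
      refine Hol.smul_mem _ (Hol.sum_mem fun q _ => ?_)
      exact rightRep_mem_holCotForms ι T hT hΨb _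
    have havgA : avg Rf K (Rf b Φ) ∈ Hol ⊓ Rf.fixedPoints K := ⟨havgHol, avg_mem_fixedPoints hKc hΨsm⟩
    have hkey : ((avg P.finRep K (P.finRep b v₀) : P.space.toSubmodule) : (adelicGroupData (↥(maximalRealSubfield L)) L (IsCMField.complexConj L) 3 H).L2 μ) = cls ⟨avg Rf K (Rf b Φ), havgHol⟩ := by
      have hform : (⟨avg Rf K (Rf b Φ), havgHol⟩ : ↥Hol) =
          (((B₀.index : ℕ) : ℂ)⁻¹ • ∑ q : K ⧸ B₀, ⟨Rf ((q.out : K) : finAdelic (↥(maximalRealSubfield L)) L (IsCMField.complexConj L) 3 H) (Rf b Φ),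
            rightRep_mem_holCotForms ι T hT hΨb _⟩ : ↥Hol) := by
        apply Subtype.ext
        simp only [Submodule.coe_smul, Submodule.coe_sum]
        rw [avg_eq_index_inv_smul_finsum B₀ le_rfl, finsum_eq_sum_of_fintype]
      rw [hform, map_smul, map_sum, avg_eq_index_inv_smul_finsum B₀ hB₀', finsum_eq_sum_of_fintype, Submodule.coe_smul, Submodule.coe_sum]
      congr 1
      exact Finset.sum_congr rfl fun q _ => ecls _
    refine ⟨⟨avg Rf K (Rf b Φ), havgA⟩, ?_⟩
    change cls (Submodule.inclusion inf_le_left ⟨avg Rf K (Rf b Φ), havgA⟩) = ((avg P.finRep K (P.finRep b v₀) : P.space.toSubmodule) : (adelicGroupData (↥(maximalRealSubfield L)) L (IsCMField.complexConj L) 3 H).L2 μ)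
    rw [hkey]
    rfl
  haveI hTfin : FiniteDimensional ℂ Tm := by
    haveI : FiniteDimensional ℂ ↥(Tm.map P.space.toSubmodule.subtype) := Submodule.finiteDimensional_of_le hTle
    exact Module.Finite.equiv (Submodule.equivMapOfInjective P.space.toSubmodule.subtype P.space.toSubmodule.injective_subtype Tm).symm
  have hTclosed : Tm.topologicalClosure = Tm := (Submodule.closed_of_finiteDimensional Tm).submodule_topologicalClosure_eq
  refine Submodule.finiteDimensional_of_le (S₂ := Tm) ?_
  rw [inf_comm, ← hTclosed]
  exact hle

/-- **(A4c) = (H5) — THE COMMON FINITE COMPONENT IS ADMISSIBLE.**  In the compact CM setting (`hdef`, `h2`), let `Φ` be a holomorphic cotangent form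
of the frame `(cmArchSection, cmCompactFactor)`, `v₀ ∈ P` a vector whose class is the class of a coordinate of `Φ` (★ B1′ `exists_vectors`:
`⟨_, hv j⟩`), and `σ` a SMOOTH representation of `U(H)(𝔸_{L⁺,f})` with an INJECTIVE `P.finRep`-equivariant linear map `ψ : σ → P` whose values lie in
`P₀ := cl span {P.finRep b v₀}` (p02's (A4b), ★ `F0P3GNSFinitePart`).  Then `σ` is ADMISSIBLE (§1 + `finiteDimensional_closureSpan_inf_fixedPoints`).
[cite: BernsteinZelevinsky1976, §2.1] [cite: BorelJacquetCorvallis1979, §4.3 and §4.6] [cite: BorelWallach2000, VII 3.2 and XIII 1.2] -/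
theorem isAdmissible_of_range_le_closureSpan
    (hdef : ∀ τ' : L →+* ℂ, InfinitePlace.mk τ' ≠ InfinitePlace.mk ι → (H.map τ').PosDef) (h2 : 2 ≤ Module.finrank ℚ ↥(maximalRealSubfield L))
    (P : DiscreteAutomorphicRep (adelicGroupData (↥(maximalRealSubfield L)) L (IsCMField.complexConj L) 3 H) μ)
    {Φ : (adelicGroupData (↥(maximalRealSubfield L)) L (IsCMField.complexConj L) 3 H).Adelic → (Fin 2 → ℂ)}
    (hΦ : Φ ∈ holCotForms (↥(maximalRealSubfield L)) L (IsCMField.complexConj L) 3 H (cmArchSection L ι H T hT) (cmCompactFactor L ι H T hT))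
    (v₀ : P.space.toSubmodule) (j : Fin 2)
    (hv₀ : ∃ hm : MemLp (toQuotFun (adelicGroupData (↥(maximalRealSubfield L)) L (IsCMField.complexConj L) 3 H) fun x => Φ x j) 2 μ,
      (v₀ : (adelicGroupData (↥(maximalRealSubfield L)) L (IsCMField.complexConj L) 3 H).L2 μ) = hm.toLp _)
    {W : Type*} [AddCommGroup W] [Module ℂ W]
    (σ : Representation ℂ (finAdelic (↥(maximalRealSubfield L)) L (IsCMField.complexConj L) 3 H) W) (hσ : σ.IsSmooth)
    (ψ : W →ₗ[ℂ] P.space.toSubmodule) (hψ : ∀ (b : finAdelic (↥(maximalRealSubfield L)) L (IsCMField.complexConj L) 3 H) (w : W),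
      ψ (σ b w) = P.finRep b (ψ w)) (hinj : Function.Injective ψ)
    (hrange : ∀ w : W, ψ w ∈ (Submodule.span ℂ (Set.range fun b => P.finRep b v₀)).topologicalClosure) :
    σ.IsAdmissible :=
  isAdmissible_of_injective_equivariant hσ ψ hψ hinj _ hrange fun K hKo hKc =>
    finiteDimensional_closureSpan_inf_fixedPoints ι T hT μ hdef h2 P hΦ v₀ j hv₀ K hKo hKc

end CM

end Summit.HodgeConjecture.HodgeConjecture.Cruxes.H413.F0P3FinComponentAdmissible

end
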